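import Literature.Barriers.SmoothPoincare4.ExoticOpenFourSpace
import Literature.Geometry.Kaehler.ChernCharacterProofs
import HarnessLib

/-!
# `deMichelisFreedman1992_continuum`: Appendix B, (B.4)–(B.5) — the Chern–Simons form of the
# connection `A = d + a` on the trivialised end, `d CS(a) = tr(F_A ∧ F_A)`, and `tr(F_A ∧ F_A) = |F_A|²`
# in a frame for ASD `A`

Proof file in the cone of the named fact
`Literature.Barriers.SmoothPoincare4.deMichelisFreedman1992_continuum` (DeMichelis–Freedman 1992,
Thm. 4.1 with Cor. 4.1: continuum many pairwise non-diffeomorphic open subsets of standard `ℝ⁴`,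
each homeomorphic to `ℝ⁴`; `ExoticOpenFourSpace.lean`), sibling of
`ExoticOpenFourSpaceEnergyDecayProofs` (the closing step (B.8) ⇒ (B.9) of Appendix B) and
`ExoticOpenFourSpaceBoundedGeometryProofs` (the standing hypotheses (1)–(2) of Appendix B for the
end-periodic end). What the cone leaves of the printed proof is the gauge theory of Thm. 2.1
("`Φ` commutes with geometric limit") with its Appendices A and B; THIS FILE renders the one step
of Appendix B that is differential ALGEBRA rather than analysis.

Appendix B ("`L²` implies `L²_δ`", pp. 251–253) estimates the energy `I_t = ∫_{τ ≥ t} |F_A|²` of a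
finite-energy ASD connection `A` over the end `E` of `M_∞`, written `A = d + a` in a
trivialisation of the bundle over the end (p. 251: "Let `A` be an ASD connection on `M` with
`A = d + a` on `E`"). The two descriptions of the Chern–Simons invariant of a slice are (p. 252–253,
verbatim):

> "Since our bundle is trivialized over the end, the Chern–Simons invariant `CS` of
> `(τ⁻¹(t₀), A|_{τ⁻¹(t₀)})` is a well-defined real number and has a 3-dimensional description very
> close to (B.3): (B.4) `CS = ∫_{τ⁻¹(t₀)} trace(a ∧ da + ⅔ a ∧ a ∧ a) dvol₃`, and also by
> Chern–Weyl theory a 4-dimensional description [3] (B.5) `CS = ∫_{τ ≥ t₀} |F_A|² dvol`"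

(`[3]` = Chern–Simons 1974). The identity behind "(B.4) = (B.5)" is Stokes' theorem on
`{τ ≥ t₀}` applied to the **transgression formula** `d tr(a ∧ da + ⅔ a ∧ a ∧ a) = tr(F_a ∧ F_a)`,
`F_a = da + a ∧ a` the curvature of `d + a` (Chern 1979, Appendix, §3 (79): "`F(Φ) = d(TF(φ))` —
`T` will be called the transgression operator", with the explicit form (121)–(122)
`TP₁(φ) = (1/8π²){Σ φ_ij ∧ Φ_ij − ⅓ Σ φ_ij ∧ φ_jk ∧ φ_ki}` of the transgression of the first
Pontrjagin form), followed by `tr(F_A ∧ F_A) = |F_A|² dvol` for ASD `A` ("The factor `½` comes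
from the fact that `A` is ASD so that the three curvature components tangent to `τ⁻¹(t₀)` are equal
in pairs to three complementary curvatures", (B.2), p. 252). We PROVE the transgression formula,
pointwise, for a matrix `a` of `1`-forms on an arbitrary real `C^∞` manifold (any model with
corners, any rank; the end of `M_∞` is an open subset of `ℝ⁴`), in the tree's calculus of matrices
of forms (`Literature.Geometry.Kaehler.MatrixForm`: `wedge`, `d`, `Matrix.trace`; pointwise
Leibniz rule `MatrixForm.d_wedge_apply`, `d ∘ d = 0` `mextDeriv_mextDeriv_of_smoothAt`,
associativity `MatrixForm.wedge_assoc` and graded cyclicity of the trace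
`MatrixForm.trace_wedge_comm`) — the real-base, trivial-bundle case which the tree's Chern–Weil
transgression `SmoothComplexVectorBundle.Connection.mextDeriv_transgressionLocal_apply`
(Kobayashi II (2.10), stated for bundles over complex-modelled bases) does not cover — and the
frame identities behind `tr(F_A ∧ F_A) = |F_A|² dvol`:

* `curvForm a = da + a ∧ a` — the curvature matrix `F_a` of the connection `d + a`
  (Kobayashi I (1.12); the tree's `Connection.curvature` in a single global frame);
* `chernSimons a = tr(a ∧ da) + ⅔ tr(a ∧ a ∧ a)` — **the Chern–Simons form (B.4)**, a `3`-form;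
  `chernSimons_eq` — `= tr(da ∧ a) + ⅔ tr(a ∧ a ∧ a)` (cyclicity);
* `trace_wedge_wedge_wedge_self` — `tr(a ∧ a ∧ a ∧ a) = 0` (graded cyclicity: a cyclic shift of
  four odd factors is an odd permutation);
* `trace_curvForm_wedge_curvForm` — `tr(F_a ∧ F_a) = tr(da ∧ da) + 2 tr(da ∧ a ∧ a)`;
* `mextDeriv_trace_d_wedge_apply` — `d tr(da ∧ a) = tr(da ∧ da)` at a point near which `a` is
  smooth (`dda = 0`); `mextDeriv_trace_wedge_wedge_apply` — `d tr(a ∧ a ∧ a) = 3 tr(da ∧ a ∧ a)`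
  there (Leibniz and cyclicity);
* `mextDeriv_chernSimons_apply` — **the transgression formula `d CS(a) = tr(F_a ∧ F_a)` at every
  point near which `a` is smooth** (Chern 1979 (79)/(122); the pointwise content of
  "(B.4) = (B.5) by Chern–Weyl theory [3]"); `mextDeriv_chernSimons` — the global form;
* `wedge_apply_two_two` — the wedge of two `2`-forms on four vectors as the sum over the six
  `(2,2)`-shuffles (Warner 2.10(b); companion of the tree's `wedge_apply_one_one`);
* `frameVal F x e p q = F(e_p, e_q)` — the matrix of values of a matrix of `2`-forms on a pair of
  four tangent vectors; `trace_wedge_apply_frame` — **`tr(F ∧ G)(e₀, …, e₃)` in terms of the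
  `F_pq`, `G_pq`**; `trace_wedge_self_apply_frame_of_asd` — **if `F₀₁ + F₂₃ = F₀₂ + F₃₁ =
  F₀₃ + F₁₂ = 0` (`F⁺ = 0` in the frame, the tree's `Literature.Geometry.GaugeTheory.IsASDIn`)
  then `tr(F ∧ F)(e₀, …, e₃) = −Σ_{p<q} tr(F_pq²)`**, which is `Σ_{p<q} |F_pq|² = |F|²` for
  skew-Hermitian values (`neg_trace_mul_self_eq_sum_norm_sq`: `−tr ξ² = Σ |ξ_ij|²`) — the
  integrand identity of (B.5); `sum_trace_sq_eq_two_smul_tangential_of_asd`,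
  `sum_trace_sq_eq_two_smul_normal_of_asd` — **"equal in pairs"**: the six-term density is twice
  its tangential (or its normal) half, the factor `½` of (B.2);
* `two_smul_trace_wedge_self_apply_frame` — for ANY `F`: `2 tr(F ∧ F)(e₀, …, e₃) = Σᵢ (tr Sᵢ² − tr Aᵢ²)`
  with `Sᵢ`, `Aᵢ` the self-dual / anti-self-dual components, i.e. `tr(F ∧ F) = ½ (|F⁻|² − |F⁺|²)`
  pointwise — the identity behind "`4π² p₁ = ∫ ‖F⁺‖² − ∫ ‖F⁻‖²`" in the proof of Point 1 of
  Thm. 2.1 (p. 224).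

NOT rendered: the integration over `{τ ≥ t₀}` (Stokes' theorem for domains is not in Mathlib) and
the rest of (B.1)–(B.8) (connections as analytic objects, the first eigenvalue of `curl`,
coarea); no named fact is introduced (D-0026).

## References

* S. DeMichelis, M. H. Freedman, *Uncountably many exotic `R⁴`'s in standard 4-space*,
  J. Differential Geom. 35 (1992) 219–254: Appendix B, (B.4)–(B.5) (pp. 252–253)
  [DeMichelisFreedman1992].
* S.-S. Chern, *Complex Manifolds without Potential Theory*, 2nd ed. (1979), Appendix "Geometry of
  characteristic classes", §3 (79) and §4 (121)–(122) [Chern1979].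
* S.-S. Chern, J. Simons, *Characteristic forms and geometric invariants*, Ann. of Math. 99 (1974)
  48–69, §3 [ChernSimons1974].
* S. Kobayashi, *Differential Geometry of Complex Vector Bundles* (1987), Ch. I §1 (1.12), Ch. II
  §2 (2.10) [Kobayashi1987].
* F. W. Warner, *Foundations of Differentiable Manifolds and Lie Groups*, GTM 94 (1983), 2.10(b)
  [WarnerGTM94].
* J. Labastida, M. Mariño, *Topological Quantum Field Theory and Four Manifolds* (2005), (2.19)
  (`F⁺ = 0` in a frame) [LabastidaMarino2005].

[DeMichelisFreedman1992]
-/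

noncomputable section

open scoped Manifold ContDiff Topology Matrix
open Set Filter
open Literature.Geometry.Kaehler

namespace Literature.Barriers.SmoothPoincare4

variable {E : Type*} [NormedAddCommGroup E] [NormedSpace ℝ E]
  {H : Type*} [TopologicalSpace H] {I : ModelWithCorners ℝ E H}
  {M : Type*} [TopologicalSpace M] [ChartedSpace H M] {r k l : ℕ}

/-! ### The curvature and the Chern–Simons form of `d + a` -/

/-- **The curvature matrix `F_a = da + a ∧ a`** of the connection `A = d + a` on a trivialised
bundle, `a` an `r × r` matrix of `1`-forms (Kobayashi I (1.12) `Ω = dω + ω ∧ ω`; the formula of the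
tree's `SmoothComplexVectorBundle.Connection.curvature` in one global frame; DeMichelis–Freedman's
`F_A`, `A = d + a` on the end, p. 251). [cite: Kobayashi1987, Ch. I §1 (1.12)] -/
def curvForm (a : MatrixForm I M r 1) : MatrixForm I M r 2 :=
  a.d + a.wedge a

/-- Unfolding `curvForm`. [folklore] -/
theorem curvForm_def (a : MatrixForm I M r 1) : curvForm a = a.d + a.wedge a := rfl

/-- **The Chern–Simons form (B.4)** of the connection `d + a` on a trivialised bundle:
`CS(a) = tr(a ∧ da + ⅔ a ∧ a ∧ a)`, a `3`-form (DeMichelis–Freedman (B.4); Chern 1979 (122):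
`TP₁(φ) = (1/8π²){Σ φ_ij ∧ Φ_ij − ⅓ Σ φ_ij ∧ φ_jk ∧ φ_ki}` up to the normalising constant, with
`Φ = dφ + φ ∧ φ`). [cite: DeMichelisFreedman1992, App. B (B.4), p. 252] -/
def chernSimons (a : MatrixForm I M r 1) : MForm I M ℂ 3 :=
  (a.wedge a.d).trace + (2 / 3 : ℝ) • ((a.wedge a).wedge a).trace

/-- Unfolding `chernSimons`. [folklore] -/
theorem chernSimons_def (a : MatrixForm I M r 1) :
    chernSimons a = (a.wedge a.d).trace + (2 / 3 : ℝ) • ((a.wedge a).wedge a).trace := rfl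

/-- `tr(a ∧ da) = tr(da ∧ a)` (graded cyclicity of the trace, the `2`-form `da` passes the
`1`-form `a` without sign), so `CS(a) = tr(da ∧ a) + ⅔ tr(a ∧ a ∧ a)`. [cite: Chern1979, App. §4 (121)–(122)] -/
theorem chernSimons_eq (a : MatrixForm I M r 1) :
    chernSimons a = (a.d.wedge a).trace + (2 / 3 : ℝ) • ((a.wedge a).wedge a).trace := by
  rw [chernSimons, MatrixForm.trace_wedge_comm a.d a, MForm.castDeg_eq_self]
  norm_num

/-! ### Algebra: `tr(a ∧ a ∧ a ∧ a) = 0` and the expansion of `tr(F_a ∧ F_a)` -/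

/-- **`tr(a ∧ a ∧ a ∧ a) = 0`** for a matrix of `1`-forms: by associativity
`(a ∧ a) ∧ (a ∧ a) = a ∧ Y` with `Y = a ∧ a ∧ a` of degree `3`, and by graded cyclicity
`tr(a ∧ Y) = (−1)^{1·3} tr(Y ∧ a) = −tr(a ∧ Y)`. [cite: Chern1979, App. §4 (121)–(122)] -/
theorem trace_wedge_wedge_wedge_self (a : MatrixForm I M r 1) :
    ((a.wedge a).wedge (a.wedge a)).trace = 0 := by
  -- `Y = a ∧ (a ∧ a)`; `(a ∧ a) ∧ (a ∧ a) = a ∧ Y` and `Y ∧ a = a ∧ Y` up to casts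
  have h1 : (a.wedge a).wedge (a.wedge a) = a.wedge (a.wedge (a.wedge a)) := by
    rw [MatrixForm.wedge_assoc, MatrixForm.castDeg_eq_self]
  have h2 : (a.wedge (a.wedge a)).wedge a = a.wedge (a.wedge (a.wedge a)) := by
    rw [MatrixForm.wedge_assoc, MatrixForm.castDeg_eq_self, MatrixForm.wedge_assoc,
      MatrixForm.castDeg_eq_self]
  have h3 := MatrixForm.trace_wedge_comm (a.wedge (a.wedge a)) a
  -- `h3 : tr(a ∧ Y) = (-1)^(3·1) • cast tr(Y ∧ a)`
  rw [MForm.castDeg_eq_self, h2] at h3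
  norm_num at h3
  -- `h3 : tr(a ∧ Y) = - tr(a ∧ Y)`
  rw [h1]
  funext x
  ext v
  have h4 := congrArg (fun T : MForm I M ℂ (1 + (1 + (1 + 1))) ↦ T x v) h3
  simp only [Pi.neg_apply, ContinuousAlternatingMap.neg_apply] at h4
  have h5 : ((a.wedge (a.wedge (a.wedge a))).trace x) v = 0 := by
    linear_combination (1 / 2 : ℂ) * h4
  simpa using h5

/-- `tr((a ∧ a) ∧ da) = tr(da ∧ a ∧ a)` (the `2`-form `da` passes the `2`-form `a ∧ a`).
[cite: Chern1979, App. §4 (121)–(122)] -/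
theorem trace_wedge_self_wedge_d (a : MatrixForm I M r 1) :
    ((a.wedge a).wedge a.d).trace = (a.d.wedge (a.wedge a)).trace := by
  rw [MatrixForm.trace_wedge_comm a.d (a.wedge a), MForm.castDeg_eq_self]
  norm_num

/-- **Expansion of the Chern–Weil `4`-form**: `tr(F_a ∧ F_a) = tr(da ∧ da) + 2 tr(da ∧ a ∧ a)`
(`tr((a ∧ a) ∧ da) = tr(da ∧ (a ∧ a))` and `tr(a ∧ a ∧ a ∧ a) = 0`). [cite: Chern1979, App. §3 (79), §4 (121)–(122)] -/
theorem trace_curvForm_wedge_curvForm (a : MatrixForm I M r 1) :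
    ((curvForm a).wedge (curvForm a)).trace =
      (a.d.wedge a.d).trace + (2 : ℝ) • (a.d.wedge (a.wedge a)).trace := by
  rw [curvForm, MatrixForm.add_wedge, MatrixForm.wedge_add, MatrixForm.wedge_add,
    Matrix.trace_add, Matrix.trace_add, Matrix.trace_add, trace_wedge_self_wedge_d,
    trace_wedge_wedge_wedge_self, add_zero, two_smul, add_assoc]

/-! ### Pointwise lemmas: traces, vanishing factors -/

section Pointwise

variable {a : MatrixForm I M r 1} {x : M}

/-- The trace of a matrix of forms evaluated at a point is the sum of the diagonal values.
[folklore] -/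
theorem trace_apply (A : MatrixForm I M r k) (x : M) : A.trace x = ∑ c, A c c x := by
  simp only [Matrix.trace, Matrix.diag_apply, Finset.sum_apply]

/-- The trace of a matrix of forms smooth at `x` is smooth at `x`. [folklore] -/
theorem smoothAt_trace {A : MatrixForm I M r k} (hA : ∀ c e, (A c e).SmoothAt x) :
    (A.trace).SmoothAt x := by
  simp only [Matrix.trace, Matrix.diag_apply]
  exact MForm.smoothAt_sum _ fun c _ ↦ hA c c

/-- `d` of the trace of a matrix of forms smooth at `x` is the trace of `d`, at `x`. [folklore] -/
theorem mextDeriv_trace_apply {A : MatrixForm I M r k} (hA : ∀ c e, (A c e).SmoothAt x) :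
    mextDeriv A.trace x = A.d.trace x := by
  simp only [Matrix.trace, Matrix.diag_apply]
  rw [mextDeriv_sum_apply_of_smoothAt _ fun c _ ↦ hA c c, Finset.sum_apply]
  rfl

/-- A matrix wedge whose left factor vanishes at `x` vanishes at `x`. [folklore] -/
theorem wedge_apply_eq_zero_of_left {A : MatrixForm I M r k} {B : MatrixForm I M r l}
    (hA : ∀ c e, A c e x = 0) (c e : Fin r) : (A.wedge B) c e x = 0 := by
  rw [MatrixForm.wedge_apply, Finset.sum_apply]
  refine Finset.sum_eq_zero fun f _ ↦ ?_
  rw [MForm.wedge_apply, hA]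
  exact ContinuousAlternatingMap.zero_wedge _

/-- A matrix wedge whose right factor vanishes at `x` vanishes at `x`. [folklore] -/
theorem wedge_apply_eq_zero_of_right {A : MatrixForm I M r k} {B : MatrixForm I M r l}
    (hB : ∀ c e, B c e x = 0) (c e : Fin r) : (A.wedge B) c e x = 0 := by
  rw [MatrixForm.wedge_apply, Finset.sum_apply]
  refine Finset.sum_eq_zero fun f _ ↦ ?_
  rw [MForm.wedge_apply, hB]
  exact ContinuousAlternatingMap.wedge_zero _

/-- `tr((da ∧ a) ∧ a) = tr(da ∧ a ∧ a)` (associativity). [folklore] -/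
theorem trace_d_wedge_wedge (a : MatrixForm I M r 1) :
    ((a.d.wedge a).wedge a).trace = (a.d.wedge (a.wedge a)).trace := by
  rw [MatrixForm.wedge_assoc, MatrixForm.castDeg_eq_self]

/-- `tr((a ∧ da) ∧ a) = −tr(da ∧ a ∧ a)`: `(a ∧ da) ∧ a = a ∧ (da ∧ a)` and the `3`-form `da ∧ a`
passes the `1`-form `a` with the sign `(−1)^{3·1}`. [cite: Chern1979, App. §4 (121)–(122)] -/
theorem trace_wedge_d_wedge (a : MatrixForm I M r 1) :
    ((a.wedge a.d).wedge a).trace = -(a.d.wedge (a.wedge a)).trace := by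
  have h := MatrixForm.trace_wedge_comm (a.d.wedge a) a
  rw [MForm.castDeg_eq_self, MatrixForm.wedge_assoc, MatrixForm.castDeg_eq_self] at h
  norm_num at h
  rw [MatrixForm.wedge_assoc, MatrixForm.castDeg_eq_self, h]

/-- Entries of `a` smooth near `x` are smooth at `x`. [folklore] -/
theorem smoothAt_of_eventually (hs : ∀ᶠ z in 𝓝 x, ∀ c e, (a c e).SmoothAt z) (c e : Fin r) :
    (a c e).SmoothAt x :=
  hs.self_of_nhds c e

end Pointwise

/-! ### Pointwise calculus: `d tr(da ∧ a)`, `d tr(a ∧ a ∧ a)` and the transgression formula -/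

section Calculus

variable [IsManifold I ∞ M] {a : MatrixForm I M r 1} {x : M}

/-- The entries of `da` are smooth at `x` if `a` is smooth near `x`. [folklore] -/
theorem smoothAt_d_of_eventually (hs : ∀ᶠ z in 𝓝 x, ∀ c e, (a c e).SmoothAt z) (c e : Fin r) :
    (a.d c e).SmoothAt x := by
  rw [MatrixForm.d_apply]
  exact MForm.SmoothAt.mextDeriv (hs.mono fun z hz ↦ hz c e)

/-- `dda = 0` at `x` if `a` is smooth near `x`. [cite: Kobayashi1987, Ch. I §1 (1.13)] -/
theorem d_d_apply_of_eventually (hs : ∀ᶠ z in 𝓝 x, ∀ c e, (a c e).SmoothAt z) (c e : Fin r) :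
    a.d.d c e x = 0 := by
  rw [MatrixForm.d_apply, MatrixForm.d_apply]
  exact mextDeriv_mextDeriv_of_smoothAt (hs.mono fun z hz ↦ hz c e)

/-- **`d tr(da ∧ a) = tr(da ∧ da)` at a point near which `a` is smooth**: Leibniz
`d(da ∧ a) = dda ∧ a + da ∧ da` and `dda = 0`. [cite: Chern1979, App. §3 (79)] -/
theorem mextDeriv_trace_d_wedge_apply (hs : ∀ᶠ z in 𝓝 x, ∀ c e, (a c e).SmoothAt z) :
    mextDeriv (a.d.wedge a).trace x = (a.d.wedge a.d).trace x := by
  have ha := smoothAt_of_eventually hs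
  have hda := smoothAt_d_of_eventually hs
  rw [mextDeriv_trace_apply (MatrixForm.smoothAt_wedge hda ha), trace_apply, trace_apply]
  refine Finset.sum_congr rfl fun c _ ↦ ?_
  have h0 : (a.d.d.wedge a) c c x = (0 : MForm I M ℂ (1 + 1 + 1 + 1)) x := by
    rw [Pi.zero_apply]
    exact wedge_apply_eq_zero_of_left (d_d_apply_of_eventually hs) c c
  rw [MatrixForm.d_wedge_apply hda ha, MatrixForm.castDeg_apply, MForm.castDeg_apply_eq _ h0,
    MForm.castDeg_zero, Pi.zero_apply, zero_add, Matrix.smul_apply, Pi.smul_apply]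
  norm_num

omit [IsManifold I ∞ M] in
/-- The value of `d(a ∧ a)` at a point near which `a` is smooth: `d(a ∧ a) = da ∧ a − a ∧ da`.
[cite: Kobayashi1987, Ch. I §1 (1.13)–(1.14)] -/
theorem d_wedge_self_apply (hs : ∀ᶠ z in 𝓝 x, ∀ c e, (a c e).SmoothAt z) (c e : Fin r) :
    (a.wedge a).d c e x = (a.d.wedge a - a.wedge a.d) c e x := by
  have ha := smoothAt_of_eventually hs
  rw [MatrixForm.d_wedge_apply ha ha, MatrixForm.castDeg_eq_self, pow_one, neg_one_smul,
    Matrix.sub_apply, Pi.sub_apply, Matrix.neg_apply, Pi.neg_apply, sub_eq_add_neg]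

/-- **`d tr(a ∧ a ∧ a) = 3 tr(da ∧ a ∧ a)` at a point near which `a` is smooth**: Leibniz gives
`d((a ∧ a) ∧ a) = (da ∧ a − a ∧ da) ∧ a + (a ∧ a) ∧ da`, and each of the three terms has trace
`tr(da ∧ a ∧ a)` by associativity and graded cyclicity. [cite: Chern1979, App. §4 (121)–(122)] -/
theorem mextDeriv_trace_wedge_wedge_apply (hs : ∀ᶠ z in 𝓝 x, ∀ c e, (a c e).SmoothAt z) :
    mextDeriv ((a.wedge a).wedge a).trace x = ((3 : ℝ) • (a.d.wedge (a.wedge a)).trace) x := by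
  have ha := smoothAt_of_eventually hs
  have hda := smoothAt_d_of_eventually hs
  have haa : ∀ c e, ((a.wedge a) c e).SmoothAt x := MatrixForm.smoothAt_wedge ha ha
  -- `d((a ∧ a) ∧ a) = d(a ∧ a) ∧ a + (a ∧ a) ∧ da` at `x`, and `d(a ∧ a) = da ∧ a − a ∧ da` at `x`
  have h1 : ∀ c, ((a.wedge a).wedge a).d c c x =
      (((a.d.wedge a).wedge a - (a.wedge a.d).wedge a) + (a.wedge a).wedge a.d) c c x := by
    intro c
    rw [MatrixForm.d_wedge_apply haa ha, MatrixForm.castDeg_apply,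
      MForm.castDeg_apply_eq _ (MatrixForm.wedge_apply_congr
        (A' := a.d.wedge a - a.wedge a.d) (B' := a) (fun f ↦ d_wedge_self_apply hs c f)
        (fun _ ↦ rfl)),
      ← MatrixForm.castDeg_apply, MatrixForm.castDeg_eq_self, MatrixForm.sub_wedge]
    norm_num
  have h2 : ((a.wedge a).wedge a).d.trace x =
      (((a.d.wedge a).wedge a - (a.wedge a.d).wedge a) + (a.wedge a).wedge a.d).trace x := by
    rw [trace_apply, trace_apply]
    exact Finset.sum_congr rfl fun c _ ↦ h1 c
  rw [mextDeriv_trace_apply (MatrixForm.smoothAt_wedge haa ha), h2, Matrix.trace_add,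
    Matrix.trace_sub, trace_d_wedge_wedge, trace_wedge_d_wedge, trace_wedge_self_wedge_d]
  simp only [Pi.add_apply, Pi.sub_apply, Pi.neg_apply, Pi.smul_apply]
  module

/-- **The transgression formula `d CS(a) = tr(F_a ∧ F_a)`, at every point near which `a` is
smooth** (Chern 1979, App. (79) `F(Φ) = d(TF(φ))` with (122); the pointwise identity behind
DeMichelis–Freedman's "(B.4) … and also by Chern–Weyl theory a 4-dimensional description [3]
(B.5)"): `d(tr(da ∧ a) + ⅔ tr(a ∧ a ∧ a)) = tr(da ∧ da) + ⅔ · 3 tr(da ∧ a ∧ a) = tr(F_a ∧ F_a)`.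
[cite: DeMichelisFreedman1992, App. B (B.4)–(B.5), pp. 252–253] -/
theorem mextDeriv_chernSimons_apply (hs : ∀ᶠ z in 𝓝 x, ∀ c e, (a c e).SmoothAt z) :
    mextDeriv (chernSimons a) x = ((curvForm a).wedge (curvForm a)).trace x := by
  have ha := smoothAt_of_eventually hs
  have hda := smoothAt_d_of_eventually hs
  have haa : ∀ c e, ((a.wedge a) c e).SmoothAt x := MatrixForm.smoothAt_wedge ha ha
  have h1 : ((a.d.wedge a).trace).SmoothAt x := smoothAt_trace (MatrixForm.smoothAt_wedge hda ha)
  have h2 : (((a.wedge a).wedge a).trace).SmoothAt x :=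
    smoothAt_trace (MatrixForm.smoothAt_wedge haa ha)
  rw [chernSimons_eq, mextDeriv_add_apply h1 (h2.smul _), mextDeriv_smul, Pi.smul_apply,
    mextDeriv_trace_d_wedge_apply hs, mextDeriv_trace_wedge_wedge_apply hs,
    trace_curvForm_wedge_curvForm]
  simp only [Pi.add_apply, Pi.smul_apply, smul_smul]
  norm_num

/-- **Global form**: for a matrix of `1`-forms smooth everywhere (e.g. the connection form of
`A = d + a` over the whole trivialised end), `d CS(a) = tr(F_a ∧ F_a)` as `4`-forms.
[cite: DeMichelisFreedman1992, App. B (B.4)–(B.5), pp. 252–253] -/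
theorem mextDeriv_chernSimons (hs : ∀ z c e, (a c e).SmoothAt z) :
    mextDeriv (chernSimons a) = ((curvForm a).wedge (curvForm a)).trace := by
  funext x
  exact mextDeriv_chernSimons_apply (Eventually.of_forall fun z ↦ hs z)

end Calculus

/-! ### The Chern–Weil `4`-form on a frame: `tr(F ∧ F)(e₀, e₁, e₂, e₃)` and anti-self-duality -/

section Frame

/-- **The wedge of two `2`-forms on four vectors** (Warner (1983), 2.10(b), the sum over the six
`(2,2)`-shuffles): `(α ∧ β)(v₀, v₁, v₂, v₃) = α₀₁β₂₃ − α₀₂β₁₃ + α₀₃β₁₂ + α₁₂β₀₃ − α₁₃β₀₂ + α₂₃β₀₁`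
(`α_ab = α(v_a, v_b)`), from the permutation-sum definition of the tree's
`ContinuousAlternatingMap.wedge` (normalisation `(2! 2!)⁻¹`, `wedge_apply`) by expanding the sum over
the `24` permutations of `Fin 4` (`Equiv.Perm.decomposeFin`) and collecting with the antisymmetry
of `α`, `β`; companion of the tree's `wedge_apply_one_one`. [cite: WarnerGTM94, 2.10(b)] -/
theorem wedge_apply_two_two {𝕜 : Type*} [RCLike 𝕜] {V : Type*} [NormedAddCommGroup V]
    [NormedSpace 𝕜 V] {A : Type*} [NormedCommRing A] [NormedAlgebra 𝕜 A]
    (α β : V [⋀^Fin 2]→L[𝕜] A) (v : Fin (2 + 2) → V) :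
    α.wedge β v =
      α ![v 0, v 1] * β ![v 2, v 3] - α ![v 0, v 2] * β ![v 1, v 3]
        + α ![v 0, v 3] * β ![v 1, v 2] + α ![v 1, v 2] * β ![v 0, v 3]
        - α ![v 1, v 3] * β ![v 0, v 2] + α ![v 2, v 3] * β ![v 0, v 1] := by
  -- the two blocks of `v ∘ σ`, for `σ` a permutation of `Fin 4`, as explicit pairs
  have lamC : ∀ σ : Equiv.Perm (Fin (2 + 2)),
      (fun i : Fin 2 ↦ v (σ (Fin.castAdd 2 i))) = ![v (σ 0), v (σ (Fin.succ 0))] := by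
    intro σ; funext i; fin_cases i <;> rfl
  have lamN : ∀ σ : Equiv.Perm (Fin (2 + 2)), (fun j : Fin 2 ↦ v (σ (Fin.natAdd 2 j))) =
      ![v (σ (Fin.succ (Fin.succ 0))), v (σ (Fin.succ (Fin.succ (Fin.succ 0))))] := by
    intro σ; funext j; fin_cases j <;> rfl
  have hdef : (default : Equiv.Perm (Fin 1)) = 1 := Subsingleton.elim _ _
  have h0s : ∀ {n : ℕ} (i : Fin n), ((0 : Fin (n + 1)) = i.succ) = False := fun i ↦
    propext ⟨fun h ↦ Fin.succ_ne_zero i h.symm, False.elim⟩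
  have s1 : (Fin.succ (0 : Fin (2 + 1)) : Fin (2 + 2)) = 1 := rfl
  have s2 : (Fin.succ (Fin.succ (0 : Fin 2)) : Fin (2 + 2)) = 2 := rfl
  have s3 : (Fin.succ (Fin.succ (Fin.succ (0 : Fin 1))) : Fin (2 + 2)) = 3 := rfl
  -- antisymmetry in the form `γ(b, a) = -γ(a, b)`
  have swap2 : ∀ (γ : V [⋀^Fin 2]→L[𝕜] A) (p q : V), γ ![q, p] = -γ ![p, q] := by
    intro γ p q
    have h := γ.toAlternatingMap.map_swap ![p, q] (i := 0) (j := 1) (by decide)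
    have h2 : (![p, q] : Fin 2 → V) ∘ (Equiv.swap (0 : Fin 2) 1) = ![q, p] := by
      funext i; fin_cases i <;> rfl
    rw [h2] at h
    exact h
  rw [ContinuousAlternatingMap.wedge_apply]
  simp only [Finset.univ_perm_fin_succ, Finset.sum_map, Equiv.toEmbedding_apply,
    ← Finset.univ_product_univ, Finset.sum_product, Fin.sum_univ_succ,
    Finset.univ_unique, Finset.sum_singleton, Equiv.Perm.decomposeFin.symm_sign, lamC, lamN,
    hdef, Fin.default_eq_zero, Equiv.Perm.decomposeFin_symm_apply_zero,
    Equiv.Perm.decomposeFin_symm_apply_succ, Equiv.Perm.one_apply, Equiv.Perm.sign_one,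
    Equiv.swap_apply_def, Fin.succ_ne_zero, Fin.succ_inj, if_true, if_false, mul_one, one_mul, h0s]
  simp only [s1, s2, s3]
  simp only [Units.smul_def, Units.val_neg, Units.val_one, mul_neg, mul_one,
    neg_neg, neg_smul, one_smul, swap2 α (v 0) (v 1), swap2 α (v 0) (v 2), swap2 α (v 0) (v 3),
    swap2 α (v 1) (v 2), swap2 α (v 1) (v 3), swap2 α (v 2) (v 3),
    swap2 β (v 0) (v 1), swap2 β (v 0) (v 2), swap2 β (v 0) (v 3),
    swap2 β (v 1) (v 2), swap2 β (v 1) (v 3), swap2 β (v 2) (v 3), neg_mul,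
    Nat.factorial, Nat.succ_eq_add_one, Nat.reduceAdd, Nat.reduceMul, Nat.cast_ofNat]
  module

/-- **The matrix of values `F_pq = F(e_p, e_q)`** of a matrix of `2`-forms on the pair `(e_p, e_q)`
of four tangent vectors `e` at `x` (tangent vectors are read in the model space `E = T_x M`;
DeMichelis–Freedman's "curvature components", p. 252; Labastida–Mariño's `F_{μν}` of the tree's
`Literature.Geometry.GaugeTheory.sdComponents`). [cite: DeMichelisFreedman1992, App. B (B.2), p. 252] -/
def frameVal (F : MatrixForm I M r 2) (x : M) (e : Fin 4 → E) (p q : Fin 4) :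
    Matrix (Fin r) (Fin r) ℂ :=
  Matrix.of fun c f ↦ F c f x ![e p, e q]

/-- Entries of `frameVal` (definitional). [folklore] -/
@[simp] theorem frameVal_apply (F : MatrixForm I M r 2) (x : M) (e : Fin 4 → E) (p q : Fin 4)
    (c f : Fin r) : frameVal F x e p q c f = F c f x ![e p, e q] := rfl

/-- `F_qp = −F_pq` (the entries of `F` are alternating). [folklore] -/
theorem frameVal_swap (F : MatrixForm I M r 2) (x : M) (e : Fin 4 → E) (p q : Fin 4) :
    frameVal F x e q p = -frameVal F x e p q := by
  ext c f
  simp only [frameVal_apply, Matrix.neg_apply]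
  have h := (F c f x).toAlternatingMap.map_swap ![e p, e q] (i := 0) (j := 1) (by decide)
  have h2 : (![e p, e q] : Fin 2 → TangentSpace I x) ∘ (Equiv.swap (0 : Fin 2) 1) = ![e q, e p] := by
    funext i; fin_cases i <;> rfl
  rw [h2] at h
  exact h

/-- **The Chern–Weil `4`-form on four vectors**: for matrices `F`, `G` of `2`-forms and tangent
vectors `e₀, …, e₃` at `x`,
`tr(F ∧ G)(e₀, e₁, e₂, e₃) = tr(F₀₁G₂₃) − tr(F₀₂G₁₃) + tr(F₀₃G₁₂) + tr(F₁₂G₀₃) − tr(F₁₃G₀₂) + tr(F₂₃G₀₁)`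
(`F_pq = frameVal F x e p q`; the shuffle formula `wedge_apply_two_two` entrywise).
[cite: WarnerGTM94, 2.10(b)] -/
theorem trace_wedge_apply_frame (F G : MatrixForm I M r 2) (x : M) (e : Fin 4 → E) :
    (F.wedge G).trace x ![e 0, e 1, e 2, e 3] =
      (frameVal F x e 0 1 * frameVal G x e 2 3).trace - (frameVal F x e 0 2 * frameVal G x e 1 3).trace
        + (frameVal F x e 0 3 * frameVal G x e 1 2).trace + (frameVal F x e 1 2 * frameVal G x e 0 3).trace
        - (frameVal F x e 1 3 * frameVal G x e 0 2).trace + (frameVal F x e 2 3 * frameVal G x e 0 1).trace := by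
  have key : ∀ c f : Fin r, ((F c f).wedge (G f c)) x ![e 0, e 1, e 2, e 3] =
      F c f x ![e 0, e 1] * G f c x ![e 2, e 3] - F c f x ![e 0, e 2] * G f c x ![e 1, e 3]
        + F c f x ![e 0, e 3] * G f c x ![e 1, e 2] + F c f x ![e 1, e 2] * G f c x ![e 0, e 3]
        - F c f x ![e 1, e 3] * G f c x ![e 0, e 2] + F c f x ![e 2, e 3] * G f c x ![e 0, e 1] := by
    intro c f
    rw [MForm.wedge_apply]
    exact wedge_apply_two_two _ _ _
  rw [trace_apply, ContinuousAlternatingMap.sum_apply]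
  simp only [MatrixForm.wedge_apply, Finset.sum_apply, ContinuousAlternatingMap.sum_apply, key,
    Finset.sum_add_distrib, Finset.sum_sub_distrib, Matrix.trace, Matrix.diag_apply,
    Matrix.mul_apply, frameVal_apply]

/-- **Anti-self-duality in the frame makes the Chern–Weil form a sum of squares**: if
`F₀₁ + F₂₃ = F₀₂ + F₃₁ = F₀₃ + F₁₂ = 0` (the tree's `Literature.Geometry.GaugeTheory.IsASDIn`:
`F⁺ = 0` in a positive orthonormal frame, Labastida–Mariño (2.19)), then
`tr(F ∧ F)(e₀, e₁, e₂, e₃) = −Σ_{p<q} tr(F_pq²)`; for `𝔰𝔲(r)`- or `𝔰𝔬(r)`-valued `F` the right-hand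
side is `Σ_{p<q} |F_pq|² = |F|²` (`neg_trace_mul_self_eq_sum_norm_sq`), i.e. `tr(F_A ∧ F_A) = |F_A|² dvol`
pointwise for an ASD connection — the integrand identity of (B.5). [cite: DeMichelisFreedman1992, App. B (B.5), p. 253] -/
theorem trace_wedge_self_apply_frame_of_asd (F : MatrixForm I M r 2) (x : M) (e : Fin 4 → E)
    (h₁ : frameVal F x e 0 1 + frameVal F x e 2 3 = 0) (h₂ : frameVal F x e 0 2 + frameVal F x e 3 1 = 0)
    (h₃ : frameVal F x e 0 3 + frameVal F x e 1 2 = 0) :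
    (F.wedge F).trace x ![e 0, e 1, e 2, e 3] =
      -((frameVal F x e 0 1 * frameVal F x e 0 1).trace + (frameVal F x e 0 2 * frameVal F x e 0 2).trace
        + (frameVal F x e 0 3 * frameVal F x e 0 3).trace + (frameVal F x e 1 2 * frameVal F x e 1 2).trace
        + (frameVal F x e 1 3 * frameVal F x e 1 3).trace + (frameVal F x e 2 3 * frameVal F x e 2 3).trace) := by
  have e23 : frameVal F x e 2 3 = -frameVal F x e 0 1 := eq_neg_of_add_eq_zero_right h₁
  have e13 : frameVal F x e 1 3 = frameVal F x e 0 2 := by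
    rw [frameVal_swap F x e 1 3, ← sub_eq_add_neg, sub_eq_zero] at h₂
    exact h₂.symm
  have e12 : frameVal F x e 1 2 = -frameVal F x e 0 3 := eq_neg_of_add_eq_zero_right h₃
  rw [trace_wedge_apply_frame, e23, e13, e12]
  simp only [Matrix.mul_neg, Matrix.neg_mul, neg_neg, Matrix.trace_neg]
  abel

/-- **"Equal in pairs" (DeMichelis–Freedman, (B.2), p. 252: "The factor `½` comes from the fact
that `A` is ASD so that the three curvature components tangent to `τ⁻¹(t₀)` are equal in pairs to
three complementary curvatures")**: under `F⁺ = 0` in the frame, with `e₀` normal and `e₁, e₂, e₃`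
tangent to the slice, `Σ_{p<q} tr(F_pq²) = 2 (tr F₁₂² + tr F₁₃² + tr F₂₃²)` — the full density is
twice its tangential part. [cite: DeMichelisFreedman1992, App. B (B.2), p. 252] -/
theorem sum_trace_sq_eq_two_smul_tangential_of_asd (F : MatrixForm I M r 2) (x : M) (e : Fin 4 → E)
    (h₁ : frameVal F x e 0 1 + frameVal F x e 2 3 = 0) (h₂ : frameVal F x e 0 2 + frameVal F x e 3 1 = 0)
    (h₃ : frameVal F x e 0 3 + frameVal F x e 1 2 = 0) :
    (frameVal F x e 0 1 * frameVal F x e 0 1).trace + (frameVal F x e 0 2 * frameVal F x e 0 2).trace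
        + (frameVal F x e 0 3 * frameVal F x e 0 3).trace + (frameVal F x e 1 2 * frameVal F x e 1 2).trace
        + (frameVal F x e 1 3 * frameVal F x e 1 3).trace + (frameVal F x e 2 3 * frameVal F x e 2 3).trace =
      (2 : ℕ) • ((frameVal F x e 1 2 * frameVal F x e 1 2).trace
        + (frameVal F x e 1 3 * frameVal F x e 1 3).trace + (frameVal F x e 2 3 * frameVal F x e 2 3).trace) := by
  have e01 : frameVal F x e 0 1 = -frameVal F x e 2 3 := eq_neg_of_add_eq_zero_left h₁
  have e02 : frameVal F x e 0 2 = frameVal F x e 1 3 := by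
    rw [frameVal_swap F x e 1 3, ← sub_eq_add_neg, sub_eq_zero] at h₂
    exact h₂
  have e03 : frameVal F x e 0 3 = -frameVal F x e 1 2 := eq_neg_of_add_eq_zero_left h₃
  rw [e01, e02, e03]
  simp only [Matrix.mul_neg, Matrix.neg_mul, neg_neg]
  abel

/-- The same with the three components through `e₀`: `Σ_{p<q} tr(F_pq²) = 2 (tr F₀₁² + tr F₀₂² + tr F₀₃²)`.
[cite: DeMichelisFreedman1992, App. B (B.2), p. 252] -/
theorem sum_trace_sq_eq_two_smul_normal_of_asd (F : MatrixForm I M r 2) (x : M) (e : Fin 4 → E)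
    (h₁ : frameVal F x e 0 1 + frameVal F x e 2 3 = 0) (h₂ : frameVal F x e 0 2 + frameVal F x e 3 1 = 0)
    (h₃ : frameVal F x e 0 3 + frameVal F x e 1 2 = 0) :
    (frameVal F x e 0 1 * frameVal F x e 0 1).trace + (frameVal F x e 0 2 * frameVal F x e 0 2).trace
        + (frameVal F x e 0 3 * frameVal F x e 0 3).trace + (frameVal F x e 1 2 * frameVal F x e 1 2).trace
        + (frameVal F x e 1 3 * frameVal F x e 1 3).trace + (frameVal F x e 2 3 * frameVal F x e 2 3).trace =
      (2 : ℕ) • ((frameVal F x e 0 1 * frameVal F x e 0 1).trace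
        + (frameVal F x e 0 2 * frameVal F x e 0 2).trace + (frameVal F x e 0 3 * frameVal F x e 0 3).trace) := by
  have e23 : frameVal F x e 2 3 = -frameVal F x e 0 1 := eq_neg_of_add_eq_zero_right h₁
  have e13 : frameVal F x e 1 3 = frameVal F x e 0 2 := by
    rw [frameVal_swap F x e 1 3, ← sub_eq_add_neg, sub_eq_zero] at h₂
    exact h₂.symm
  have e12 : frameVal F x e 1 2 = -frameVal F x e 0 3 := eq_neg_of_add_eq_zero_right h₃
  rw [e23, e13, e12]
  simp only [Matrix.mul_neg, Matrix.neg_mul, neg_neg]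
  abel

omit [NormedSpace ℝ E] [ChartedSpace H M] in
/-- **`−tr(ξ²) = Σ_{ij} |ξ_ij|²` for a skew-Hermitian matrix** `ξ` (`ξᴴ = −ξ`, e.g. `ξ ∈ 𝔰𝔲(r)` or real
`ξ ∈ 𝔰𝔬(r)`): the squared norm "relative to the Killing form" of the tree's `adNormSq`
(`|ξ|² = −tr ξ²`, Donaldson–Kronheimer §2.1), which makes `−Σ_{p<q} tr(F_pq²)` the pointwise
`|F|² ≥ 0` of `trace_wedge_self_apply_frame_of_asd`. [folklore] -/
theorem neg_trace_mul_self_eq_sum_norm_sq {ξ : Matrix (Fin r) (Fin r) ℂ} (hξ : ξ.conjTranspose = -ξ) :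
    -(ξ * ξ).trace = ∑ i, ∑ j, ((‖ξ i j‖ ^ 2 : ℝ) : ℂ) := by
  have h : ∀ i j, ξ j i = -star (ξ i j) := fun i j ↦ by
    have h1 : star (ξ i j) = -ξ j i := by
      have := congrFun (congrFun hξ j) i
      rwa [Matrix.conjTranspose_apply, Matrix.neg_apply] at this
    rw [h1, neg_neg]
  simp only [Matrix.trace, Matrix.diag_apply, Matrix.mul_apply, ← Finset.sum_neg_distrib]
  refine Finset.sum_congr rfl fun i _ ↦ Finset.sum_congr rfl fun j _ ↦ ?_
  have hc : ξ i j * star (ξ i j) = (Complex.normSq (ξ i j) : ℂ) := Complex.mul_conj (ξ i j)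
  rw [h i j, mul_neg, neg_neg, hc, Complex.normSq_eq_norm_sq]

/-- **`tr(F ∧ F) = ½ (|F⁻|² − |F⁺|²)` pointwise**: for ANY matrix `F` of `2`-forms and four tangent
vectors, with the self-dual components `S₁ = F₀₁ + F₂₃`, `S₂ = F₀₂ + F₃₁`, `S₃ = F₀₃ + F₁₂` and the
anti-self-dual components `A₁ = F₀₁ − F₂₃`, `A₂ = F₀₂ − F₃₁`, `A₃ = F₀₃ − F₁₂` (the tree's
`sdComponents` / `asdComponents`, Labastida–Mariño (2.18)–(2.19)),
`2 tr(F ∧ F)(e₀, e₁, e₂, e₃) = Σᵢ (tr Sᵢ² − tr Aᵢ²)` — with `|ξ|² = −tr ξ²` this is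
`tr(F ∧ F) = ½ (|F⁻|² − |F⁺|²)`, the pointwise identity behind the Chern–Weil formula
"`4π² p₁ = ∫ ‖F⁺‖² − ∫ ‖F⁻‖²`" invoked in the proof of Point 1 of Thm. 2.1 (p. 224: a bundle "with
positive `p₁` and a connection with arbitrarily small self-dual curvature" is contradictory), up to
the normalisations of `|·|` and `p₁`. [cite: DeMichelisFreedman1992, §2, proof of Thm. 2.1, Point 1, p. 224] -/
theorem two_smul_trace_wedge_self_apply_frame (F : MatrixForm I M r 2) (x : M) (e : Fin 4 → E) :
    (2 : ℕ) • (F.wedge F).trace x ![e 0, e 1, e 2, e 3] =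
      ((frameVal F x e 0 1 + frameVal F x e 2 3) * (frameVal F x e 0 1 + frameVal F x e 2 3)).trace
        - ((frameVal F x e 0 1 - frameVal F x e 2 3) * (frameVal F x e 0 1 - frameVal F x e 2 3)).trace
      + (((frameVal F x e 0 2 + frameVal F x e 3 1) * (frameVal F x e 0 2 + frameVal F x e 3 1)).trace
        - ((frameVal F x e 0 2 - frameVal F x e 3 1) * (frameVal F x e 0 2 - frameVal F x e 3 1)).trace)
      + (((frameVal F x e 0 3 + frameVal F x e 1 2) * (frameVal F x e 0 3 + frameVal F x e 1 2)).trace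
        - ((frameVal F x e 0 3 - frameVal F x e 1 2) * (frameVal F x e 0 3 - frameVal F x e 1 2)).trace) := by
  rw [trace_wedge_apply_frame, frameVal_swap F x e 1 3]
  simp only [Matrix.add_mul, Matrix.mul_add, Matrix.sub_mul, Matrix.mul_sub, Matrix.trace_add,
    Matrix.trace_sub, Matrix.mul_neg, Matrix.neg_mul, Matrix.trace_neg]
  rw [Matrix.trace_mul_comm (frameVal F x e 2 3) (frameVal F x e 0 1),
    Matrix.trace_mul_comm (frameVal F x e 1 3) (frameVal F x e 0 2),
    Matrix.trace_mul_comm (frameVal F x e 1 2) (frameVal F x e 0 3)]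
  abel

end Frame

end Literature.Barriers.SmoothPoincare4
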